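import Literature.AnabelianGeometry.EtaleTheta.DivisorMonoidsRootLaw
import Literature.AnabelianGeometry.SemiGraphs.TemperoidsGaloisObjectsProofs

/-!
# [EtTh] §4: every connected tempered covering is DOMINATED BY A GALOIS ONE — the «lift of coverings along the base»
# input of `baseRootLaw_of_rootLaw` is a THEOREM at print's base `D₀ = B^temp(Π^tp_X)⁰` for `IG` = Galois

S. Mochizuki, *The étale theta function …*, Publ. RIMS **45** (2009) [MochizukiEtTh2009], §4 Def. 4.1 (ii) p.87 («We shall
say that `A` is Galois if `A^bs ∈ Ob(D)` is Galois»), Prop. 4.2 (iii) proof p.89 (roots over Galois coverings);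
S. Mochizuki, *Semi-graphs of anabelioids* (2006) [MochizukiSemiAnbd2006], §3 Def. 3.1 (i) («tempered»: the open normal
subgroups form a basis of neighbourhoods of the identity), Def. 3.1 (iv) (Galois objects), Rmk. 3.1.2–3.1.3 (`Π/H`; Galois
⟺ `≅ Π/N`, `N` open normal) [cite: MochizukiEtTh2009, Prop 4.2 (iii) p.89].

abc-iut cell, layer L2; seat abc-iut-L2-t3 (gen 5); A10 / G-w4d044-3 lineage (`TemperedFrobenioid.baseRootLaw_of_rootLaw`,
p449939, derives the §4 binder `hR₀` from the data-level root law PLUS a lift hypothesis `hLift` «every covering of `Y_X` in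
`D₀` is dominated by the image of an `IG`-cover of `X`»).  PROOF-ONLY (0 defs); inputs BY NAME: abc-iut-L3's `IsTempered.basis`,
`BTemp.quotientObj`, `GaloisObjects.exists_hom_quotientObj` / `isGaloisObj_of_iso_quotientObj` ([SemiAnbd] Rmk. 3.1.3
discharged, `TemperoidsGaloisObjectsProofs.lean`), abc-iut-L1's `BTempConnected` API; nothing landed is edited.
* `BTemp.exists_hom_from_isGaloisObj` — for `Π` tempered, every connected object `Y` of `B^temp(Π)` receives a morphism
  from a GALOIS object (`Π/N → Y` for an open normal `N` inside the open stabiliser of a point: Def. 3.1 (i) basis);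
  `ConnectedPart.exists_hom_from_isGaloisObj` — the same in `B^temp(Π)⁰`.
* **`ConnectedPart.hLift_galois_idBase`** — the hypothesis `hLift` of `baseRootLaw_of_rootLaw` HOLDS for the identity base
  functor of `B^temp(Π)⁰` and `IG := «A^bs Galois»` (Def. 4.1 (ii)): so for every tempered Frobenioid of monoid type `ℤ`
  whose base functor is `𝟭_{B^temp(Π)⁰}` (abc-iut-w6-d048's tempered models of record, the v2 `ofTower`-data) the §4 binder
  `hR₀` reduces to the data-level root law `DivisorMonoids.RootLaw` ALONE.
HONEST FRAMING: refereed pre-IUT group theory over the typed `IsTempered`; typed ≠ proved — here proved; nothing here bears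
on the disputed [IUTchIII] Cor. 3.12.
-/

noncomputable section

namespace Literature.AnabelianGeometry.EtaleTheta

open CategoryTheory Literature.AlgebraicGeometry.Frobenioids Literature.AlgebraicGeometry.Frobenioids.QuasiTemperoid
  Literature.AnabelianGeometry.SemiGraphs Literature.AnabelianGeometry.SemiGraphs.GaloisObjects

universe u

variable {G : Type u} [Group G] [TopologicalSpace G] [IsTopologicalGroup G]

/-- **Every connected object of `B^temp(Π)` is dominated by a Galois object** (`Π` tempered): the stabiliser of a point
`y` is open, hence contains an open normal `N` ([SemiAnbd] Def. 3.1 (i): the open normal subgroups form a basis of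
neighbourhoods of `1`), and `gN ↦ g·y` is a morphism `Π/N → Y` out of the Galois object `Π/N` (Rmk. 3.1.2–3.1.3).
[cite: MochizukiSemiAnbd2006, Rmk 3.1.3 p.34] -/
theorem BTemp.exists_hom_from_isGaloisObj (hG : IsTempered G) (Y : BTemp G) (hY : IsConnectedObj Y) :
    ∃ X : BTemp G, IsGaloisObj X ∧ Nonempty (X ⟶ Y) := by
  obtain ⟨y⟩ := BTempConnected.nonempty_of_isConnectedObj Y hY
  have hopen : IsOpen {g : G | Y.obj.ρ g y = y} := Y.property.2 y
  have hmem : {g : G | Y.obj.ρ g y = y} ∈ nhds (1 : G) :=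
    hopen.mem_nhds (show Y.obj.ρ 1 y = y from BTempConnected.ρ_one_apply Y y)
  obtain ⟨N, -, hN⟩ := hG.basis _ hmem
  obtain ⟨f, -⟩ := exists_hom_quotientObj hG N.toSubgroup N.isOpen' y fun k hk => hN hk
  exact ⟨BTemp.quotientObj G hG N.toSubgroup N.isOpen', isGaloisObj_of_iso_quotientObj hG _ N (Iso.refl _), ⟨f⟩⟩

/-- The same in the connected part `B^temp(Π)⁰` (= [EtTh]'s `D₀`): every object receives a morphism from an object whose
underlying `Π`-set is Galois. [cite: MochizukiEtTh2009, Def 4.1 (ii) p.87] -/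
theorem ConnectedPart.exists_hom_from_isGaloisObj (hG : IsTempered G) (Y : ConnectedPart (BTemp G)) :
    ∃ X : ConnectedPart (BTemp G), IsGaloisObj X.obj ∧ Nonempty (X ⟶ Y) := by
  obtain ⟨X, hX, ⟨f⟩⟩ := BTemp.exists_hom_from_isGaloisObj hG Y.obj Y.property
  exact ⟨⟨X, hX.1⟩, hX, ⟨⟨f⟩⟩⟩

/-- **The lift hypothesis `hLift` of `TemperedFrobenioid.baseRootLaw_of_rootLaw` HOLDS for the identity base functor of
`B^temp(Π)⁰` and `IG := «Galois»`** (Def. 4.1 (ii)): every covering `Y' → Y_X` is dominated by a Galois `X' → X` — take a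
Galois `X' → Y'` and compose.  Hence, for base `𝟭_{B^temp(Π)⁰}`, the §4 binder `hR₀` (A10) follows from the data-level
root law `DivisorMonoids.RootLaw` alone. [cite: MochizukiEtTh2009, Prop 4.2 (iii) p.89] -/
theorem ConnectedPart.hLift_galois_idBase (hG : IsTempered G) :
    ∀ (X : ConnectedPart (BTemp G)), IsGaloisObj X.obj →
      ∀ (Y' : ConnectedPart (BTemp G)) (f : Y' ⟶ (𝟭 (ConnectedPart (BTemp G))).obj X),
        ∃ (X' : ConnectedPart (BTemp G)) (_ : IsGaloisObj X'.obj) (c : X' ⟶ X)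
          (g : (𝟭 (ConnectedPart (BTemp G))).obj X' ⟶ Y'), g ≫ f = (𝟭 (ConnectedPart (BTemp G))).map c := by
  intro X _ Y' f
  obtain ⟨X', hX', ⟨g⟩⟩ := ConnectedPart.exists_hom_from_isGaloisObj hG Y'
  exact ⟨X', hX', g ≫ f, g, rfl⟩

omit [IsTopologicalGroup G] in
/-- Variant with the trivially true `IG` (every object admissible as a cover): the lift holds with `X' := Y'`.
[cite: MochizukiEtTh2009, Prop 4.2 (iii) p.89] -/
theorem ConnectedPart.hLift_top_idBase :
    ∀ (X : ConnectedPart (BTemp G)), True →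
      ∀ (Y' : ConnectedPart (BTemp G)) (f : Y' ⟶ (𝟭 (ConnectedPart (BTemp G))).obj X),
        ∃ (X' : ConnectedPart (BTemp G)) (_ : True) (c : X' ⟶ X)
          (g : (𝟭 (ConnectedPart (BTemp G))).obj X' ⟶ Y'), g ≫ f = (𝟭 (ConnectedPart (BTemp G))).map c :=
  fun _ _ Y' f => ⟨Y', trivial, f, 𝟙 Y', Category.id_comp f⟩

end Literature.AnabelianGeometry.EtaleTheta

end
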